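import Mathlib
import HarnessLib
import Summits.KontsevichZagierPeriods.KontsevichZagierPeriods.Theorems.SoloInformedLogRoomCore

/-!
# SoloInformed — log-room estimates II: endpoint log-singularities (LEMMA I programme, file F1b)

Solo programme `solo-KontsevichZagierPeriods-informed`, session s140; continues
`SoloInformedLogRoomCore`.  The ONE-VARIABLE LOG-ROOM LEMMA says that on an interval
`J = (α₀, β₀) ⊆ (0, ∞)` a power weight `u^r` leaves room for any power of a logarithmic singularity
sitting at an endpoint of `J` (or outside `J`): `∫_J u^r |log|u - d||^p du ≤ C(r,p) · Λ^p · ∫_J u^r du`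
with `Λ` an explicit `1 + Σ log⁺(semialgebraic data)`.  This file proves the two endpoint cases:

* `soloInformed_logRoom_origin`: the singularity `log⁺ u⁻¹` at the origin on `(0, β₀)`;
* the shared pieces of the endpoint cases (file F1c `SoloInformedLogRoomLeftRight`): scale
  splitting `soloInformed_posLog_inv_le_scale`, the power bound `soloInformed_posLog_inv_pow_le`,
  `soloInformed_scale_rpow_mul_le_one`, and the constant bookkeeping
  `soloInformed_logRoom_finalConst`.

Method (folklore): split the logarithm at the natural scale (`log s⁻¹ = log L⁻¹ + log (L/s)`), absorb
`log (L/s) ≤ (L/s)^ε / ε` into the power weight on the normalised variable only, and compare the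
resulting endpoint integral with `∫_J u^r` through the two-sided pinching of `u^r` on a dyadic
block.  References: J.-M. Lion, J.-P. Rolin, Ann. Inst. Fourier 48 (1998) 755–767, §1; G. Comte,
J.-M. Lion, J.-P. Rolin, Illinois J. Math. 44 (2000) 884–888, Thm. 3.
-/

noncomputable section

open scoped ENNReal
open MeasureTheory Set Real

namespace Summit.KontsevichZagierPeriods.KontsevichZagierPeriods.Theorems

/-! ### Small helpers -/

/-- Pull a nonnegative real constant out of `∫⁻ ofReal (A * f)`. [cite: LionRolin1998, §1] -/
theorem soloInformed_setLIntegral_ofReal_const_mul {A : ℝ} (hA : 0 ≤ A) (f : ℝ → ℝ) (S : Set ℝ) :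
    ∫⁻ u in S, ENNReal.ofReal (A * f u) = ENNReal.ofReal A * ∫⁻ u in S, ENNReal.ofReal (f u) := by
  simp_rw [ENNReal.ofReal_mul hA]
  exact lintegral_const_mul' _ _ ENNReal.ofReal_ne_top

/-- Measurability of `u ↦ ofReal (A * u^s)`. [cite: LionRolin1998, §1] -/
theorem soloInformed_measurable_ofReal_const_mul_rpow (A s : ℝ) :
    Measurable fun u : ℝ => ENNReal.ofReal (A * u ^ s) :=
  (measurable_const.mul (measurable_id.pow_const s)).ennreal_ofReal

/-- Measurability of `u ↦ ofReal (A * (u - a)^s)`. [cite: LionRolin1998, §1] -/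
theorem soloInformed_measurable_ofReal_const_mul_rpow_sub (A a s : ℝ) :
    Measurable fun u : ℝ => ENNReal.ofReal (A * (u - a) ^ s) :=
  (measurable_const.mul ((measurable_id.sub_const a).pow_const s)).ennreal_ofReal

/-- Measurability of `u ↦ ofReal (A * (b - u)^s)`. [cite: LionRolin1998, §1] -/
theorem soloInformed_measurable_ofReal_const_mul_rpow_sub' (A b s : ℝ) :
    Measurable fun u : ℝ => ENNReal.ofReal (A * (b - u) ^ s) :=
  (measurable_const.mul ((measurable_const.sub measurable_id).pow_const s)).ennreal_ofReal

/-- Algebra of the absorbed term: `u^r · ((L/s)^ε/ε)^p = ε⁻¹^p · L^{εp} · (u^r · s^{-εp})` for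
`0 ≤ L`, `0 < s`. [cite: LionRolin1998, §1] -/
theorem soloInformed_rpow_mul_absorb_pow {L s ε : ℝ} (p : ℕ) (hL : 0 ≤ L) (hs : 0 < s) (w : ℝ) :
    w * ((L / s) ^ ε / ε) ^ p = ε⁻¹ ^ p * L ^ (ε * p) * (w * s ^ (-(ε * p))) := by
  rw [div_pow, ← Real.rpow_natCast ((L / s) ^ ε) p, ← Real.rpow_mul (div_nonneg hL hs.le),
    Real.div_rpow hL hs.le, Real.rpow_neg hs.le, inv_pow]
  ring

/-! ### The origin: `log⁺ u⁻¹` on `(0, β₀)` -/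

/-- Scale splitting at the origin: for `0 < u`, `0 < β₀` and `0 < ε`,
`log⁺ u⁻¹ ≤ log⁺ β₀⁻¹ + (β₀/u)^ε / ε`. [cite: LionRolin1998, §1] -/
theorem soloInformed_posLog_inv_le_origin {β₀ u ε : ℝ} (hβ : 0 < β₀) (hu : 0 < u)
    (hε : 0 < ε) : log⁺ u⁻¹ ≤ log⁺ β₀⁻¹ + (β₀ / u) ^ ε / ε := by
  have hY : 0 ≤ (β₀ / u) ^ ε / ε := div_nonneg (Real.rpow_nonneg (div_nonneg hβ.le hu.le) ε) hε.le
  have hX : 0 ≤ log⁺ β₀⁻¹ := Real.posLog_nonneg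
  rcases le_or_gt 1 u with h1 | h1
  · rw [soloInformed_posLog_eq_zero_of_le_one (inv_nonneg.2 hu.le) (inv_le_one_of_one_le₀ h1)]
    exact add_nonneg hX hY
  · set m := min β₀ 1 with hm_def
    have hm : 0 < m := lt_min hβ one_pos
    have hmβ : m ≤ β₀ := min_le_left _ _
    have h1u : 1 ≤ u⁻¹ := (one_le_inv₀ hu).2 h1.le
    rw [soloInformed_posLog_eq_log_of_one_le h1u, soloInformed_log_inv_eq_add hm hu]
    have hA : Real.log m⁻¹ ≤ log⁺ β₀⁻¹ := by
      calc Real.log m⁻¹ ≤ log⁺ m⁻¹ := by rw [Real.posLog_def]; exact le_max_right _ _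
        _ ≤ log⁺ β₀⁻¹ + log⁺ (1 : ℝ)⁻¹ := soloInformed_posLog_inv_min_le β₀ 1
        _ = log⁺ β₀⁻¹ := by
            rw [inv_one, soloInformed_posLog_eq_zero_of_le_one zero_le_one le_rfl, add_zero]
    have hB : Real.log (m / u) ≤ (β₀ / u) ^ ε / ε := by
      calc Real.log (m / u) ≤ (m / u) ^ ε / ε := soloInformed_log_div_le_rpow_div hm.le hu hε
        _ ≤ (β₀ / u) ^ ε / ε := by
            gcongr
    linarith

/-- Pointwise majorant at the origin (any `r`, `0 < ε`): for `0 < u`,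
`u^r (log⁺ u⁻¹)^p ≤ 2^p X^p u^r + 2^p ε⁻¹^p β₀^{εp} u^{r-εp}` with `X = log⁺ β₀⁻¹`.
[cite: LionRolin1998, §1] -/
theorem soloInformed_origin_pointwise {r ε β₀ u : ℝ} (p : ℕ) (hε : 0 < ε) (hβ : 0 < β₀) (hu : 0 < u) :
    u ^ r * (log⁺ u⁻¹) ^ p ≤ 2 ^ p * (log⁺ β₀⁻¹) ^ p * u ^ r +
      2 ^ p * ε⁻¹ ^ p * β₀ ^ (ε * p) * u ^ (r + -(ε * p)) := by
  set X := log⁺ β₀⁻¹ with hX_def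
  have hX : 0 ≤ X := Real.posLog_nonneg
  have hY : 0 ≤ (β₀ / u) ^ ε / ε := div_nonneg (Real.rpow_nonneg (div_nonneg hβ.le hu.le) ε) hε.le
  have h0 : 0 ≤ log⁺ u⁻¹ := Real.posLog_nonneg
  have hL := soloInformed_posLog_inv_le_origin hβ hu hε
  have h2 : (log⁺ u⁻¹) ^ p ≤ 2 ^ p * (X ^ p + ((β₀ / u) ^ ε / ε) ^ p) :=
    (pow_le_pow_left₀ h0 hL p).trans (soloInformed_add_pow_le_two_pow p hX hY)
  have hur : 0 ≤ u ^ r := Real.rpow_nonneg hu.le r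
  calc u ^ r * (log⁺ u⁻¹) ^ p ≤ u ^ r * (2 ^ p * (X ^ p + ((β₀ / u) ^ ε / ε) ^ p)) :=
        mul_le_mul_of_nonneg_left h2 hur
    _ = 2 ^ p * X ^ p * u ^ r + 2 ^ p * (u ^ r * ((β₀ / u) ^ ε / ε) ^ p) := by ring
    _ = 2 ^ p * X ^ p * u ^ r + 2 ^ p * ε⁻¹ ^ p * β₀ ^ (ε * p) * u ^ (r + -(ε * p)) := by
        rw [soloInformed_rpow_mul_absorb_pow p hβ.le hu, Real.rpow_add hu]; ring

/-- LOG-ROOM AT THE ORIGIN. For every real exponent `r` and every `p ≥ 1` there is `C ≥ 1` with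
`∫⁻_{(0,β₀)} u^r (log⁺ u⁻¹)^p ≤ C (1 + log⁺ β₀⁻¹)^p · ∫⁻_{(0,β₀)} u^r` for all `β₀ > 0` (both sides
are `∞` when `r ≤ -1`). [cite: LionRolin1998, §1] -/
theorem soloInformed_logRoom_origin (r : ℝ) {p : ℕ} (hp : 0 < p) :
    ∃ C : ℝ, 1 ≤ C ∧ ∀ β₀ : ℝ, 0 < β₀ →
      ∫⁻ u in Ioo 0 β₀, ENNReal.ofReal (u ^ r * (log⁺ u⁻¹) ^ p) ≤
        ENNReal.ofReal (C * (1 + log⁺ β₀⁻¹) ^ p) * ∫⁻ u in Ioo 0 β₀, ENNReal.ofReal (u ^ r) := by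
  by_cases hr : r ≤ -1
  · refine ⟨1, le_rfl, fun β₀ hβ => ?_⟩
    rw [soloInformed_lintegral_rpow_Ioo_eq_top hr hβ]
    have hX : 0 ≤ log⁺ β₀⁻¹ := Real.posLog_nonneg
    exact soloInformed_le_ofReal_mul_top (by positivity) _
  rw [not_le] at hr
  have hp' : (0 : ℝ) < p := by exact_mod_cast hp
  set ε : ℝ := (r + 1) / (2 * p) with hε_def
  have hε : 0 < ε := div_pos (by linarith) (by positivity)
  have hεp : ε * p = (r + 1) / 2 := by rw [hε_def]; field_simp
  set E : ℝ := max 1 (ε⁻¹ ^ p) with hE_def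
  have hE1 : 1 ≤ E := le_max_left _ _
  have hEε : ε⁻¹ ^ p ≤ E := le_max_right _ _
  refine ⟨2 ^ (p + 2) * E, ?_, fun β₀ hβ => ?_⟩
  · exact one_le_mul_of_one_le_of_one_le (one_le_pow₀ (by norm_num)) hE1
  set X := log⁺ β₀⁻¹ with hX_def
  have hX : 0 ≤ X := Real.posLog_nonneg
  set I := ∫⁻ u in Ioo 0 β₀, ENNReal.ofReal (u ^ r) with hI_def
  -- constants of the pointwise majorant
  set A : ℝ := 2 ^ p * X ^ p with hA_def
  set B : ℝ := 2 ^ p * ε⁻¹ ^ p * β₀ ^ (ε * p) with hB_def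
  have hA : 0 ≤ A := by positivity
  have hB : 0 ≤ B := by positivity
  have hpt : ∀ u ∈ Ioo 0 β₀, ENNReal.ofReal (u ^ r * (log⁺ u⁻¹) ^ p) ≤
      ENNReal.ofReal (A * u ^ r) + ENNReal.ofReal (B * u ^ (r + -(ε * p))) := by
    intro u hu
    rw [← ENNReal.ofReal_add (mul_nonneg hA (Real.rpow_nonneg hu.1.le _))
      (mul_nonneg hB (Real.rpow_nonneg hu.1.le _))]
    exact ENNReal.ofReal_le_ofReal (soloInformed_origin_pointwise p hε hβ hu.1)
  -- the exponent of the absorbed term is still integrable at the origin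
  have hγ : -1 < r + -(ε * p) := by rw [hεp]; linarith
  have hIγ : ∫⁻ u in Ioo 0 β₀, ENNReal.ofReal (u ^ (r + -(ε * p))) =
      ENNReal.ofReal (β₀ ^ (r + -(ε * p) + 1) / (r + -(ε * p) + 1)) :=
    soloInformed_lintegral_rpow_Ioo hγ hβ.le
  have hIr : I = ENNReal.ofReal (β₀ ^ (r + 1) / (r + 1)) := soloInformed_lintegral_rpow_Ioo hr hβ.le
  -- the absorbed term integrates to `2^{p+1} ε⁻¹^p · I`
  have hkey : B * (β₀ ^ (r + -(ε * p) + 1) / (r + -(ε * p) + 1)) =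
      2 ^ (p + 1) * ε⁻¹ ^ p * (β₀ ^ (r + 1) / (r + 1)) := by
    have h1 : r + -(ε * p) + 1 = (r + 1) / 2 := by rw [hεp]; ring
    have h2 : β₀ ^ (ε * p) * β₀ ^ ((r + 1) / 2) = β₀ ^ (r + 1) := by
      rw [← Real.rpow_add hβ, hεp]; ring_nf
    rw [h1, hB_def]
    have h3 : (r + 1) / 2 ≠ 0 := by
      have : 0 < r + 1 := by linarith
      positivity
    calc 2 ^ p * ε⁻¹ ^ p * β₀ ^ (ε * p) * (β₀ ^ ((r + 1) / 2) / ((r + 1) / 2))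
        = 2 ^ p * ε⁻¹ ^ p * (β₀ ^ (ε * p) * β₀ ^ ((r + 1) / 2)) * (2 / (r + 1)) := by
          field_simp
      _ = 2 ^ (p + 1) * ε⁻¹ ^ p * (β₀ ^ (r + 1) / (r + 1)) := by rw [h2]; ring
  calc ∫⁻ u in Ioo 0 β₀, ENNReal.ofReal (u ^ r * (log⁺ u⁻¹) ^ p)
      ≤ ∫⁻ u in Ioo 0 β₀, (ENNReal.ofReal (A * u ^ r) + ENNReal.ofReal (B * u ^ (r + -(ε * p)))) :=
        setLIntegral_mono' measurableSet_Ioo hpt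
    _ = (∫⁻ u in Ioo 0 β₀, ENNReal.ofReal (A * u ^ r)) +
          ∫⁻ u in Ioo 0 β₀, ENNReal.ofReal (B * u ^ (r + -(ε * p))) :=
        lintegral_add_left (soloInformed_measurable_ofReal_const_mul_rpow A r) _
    _ = ENNReal.ofReal A * I + ENNReal.ofReal B * ∫⁻ u in Ioo 0 β₀, ENNReal.ofReal (u ^ (r + -(ε * p))) := by
        rw [soloInformed_setLIntegral_ofReal_const_mul hA, soloInformed_setLIntegral_ofReal_const_mul hB]
    _ = ENNReal.ofReal A * I + ENNReal.ofReal (2 ^ (p + 1) * ε⁻¹ ^ p) * I := by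
        rw [hIγ, ← ENNReal.ofReal_mul hB, hkey,
          ENNReal.ofReal_mul (p := 2 ^ (p + 1) * ε⁻¹ ^ p) (by positivity), ← hIr]
    _ = ENNReal.ofReal (A + 2 ^ (p + 1) * ε⁻¹ ^ p) * I := by
        rw [← add_mul, ← ENNReal.ofReal_add hA (by positivity)]
    _ ≤ ENNReal.ofReal (2 ^ (p + 2) * E * (1 + X) ^ p) * I := by
        gcongr
        -- `2^p X^p + 2^{p+1} ε⁻¹^p ≤ 2^{p+2} E (1+X)^p`
        have h1 : X ^ p ≤ E * (1 + X) ^ p := by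
          calc X ^ p ≤ (1 + X) ^ p := by gcongr; linarith
            _ = 1 * (1 + X) ^ p := (one_mul _).symm
            _ ≤ E * (1 + X) ^ p := by gcongr
        have h2 : ε⁻¹ ^ p ≤ E * (1 + X) ^ p := by
          calc ε⁻¹ ^ p ≤ E := hEε
            _ = E * 1 := (mul_one _).symm
            _ ≤ E * (1 + X) ^ p := by
                have hE0 : 0 ≤ E := zero_le_one.trans hE1
                gcongr
                exact one_le_pow₀ (by linarith)
        calc A + 2 ^ (p + 1) * ε⁻¹ ^ p = 2 ^ p * X ^ p + 2 ^ (p + 1) * ε⁻¹ ^ p := by rw [hA_def]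
          _ ≤ 2 ^ p * (E * (1 + X) ^ p) + 2 ^ (p + 1) * (E * (1 + X) ^ p) := by gcongr
          _ = 3 * (2 ^ p * (E * (1 + X) ^ p)) := by ring
          _ ≤ 4 * (2 ^ p * (E * (1 + X) ^ p)) := by gcongr; norm_num
          _ = 2 ^ (p + 2) * E * (1 + X) ^ p := by ring

/-! ### Shared pieces for the endpoint lemmas -/

/-- Scale splitting at an endpoint: for `0 < L ≤ 1`, `0 < s`, `0 < ε`,
`log⁺ s⁻¹ ≤ log⁺ L⁻¹ + (L/s)^ε / ε`. [cite: LionRolin1998, §1] -/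
theorem soloInformed_posLog_inv_le_scale {L s ε : ℝ} (hL : 0 < L) (hL1 : L ≤ 1) (hs : 0 < s)
    (hε : 0 < ε) : log⁺ s⁻¹ ≤ log⁺ L⁻¹ + (L / s) ^ ε / ε := by
  have hY : 0 ≤ (L / s) ^ ε / ε := div_nonneg (Real.rpow_nonneg (div_nonneg hL.le hs.le) ε) hε.le
  rcases le_or_gt L s with hLs | hLs
  · have := soloInformed_posLog_inv_antitone hL hLs
    linarith
  · have h1s : 1 ≤ s⁻¹ := (one_le_inv₀ hs).2 (hLs.le.trans hL1)
    rw [soloInformed_posLog_eq_log_of_one_le h1s, soloInformed_log_inv_eq_add hL hs]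
    have hA : Real.log L⁻¹ ≤ log⁺ L⁻¹ := by rw [Real.posLog_def]; exact le_max_right _ _
    have hB : Real.log (L / s) ≤ (L / s) ^ ε / ε := soloInformed_log_div_le_rpow_div hL.le hs hε
    linarith

/-- From the scale splitting to a power bound:
`(log⁺ s⁻¹)^p ≤ 2^p X^p + 2^p ε⁻¹^p L^{εp} s^{-εp}`. [cite: LionRolin1998, §1] -/
theorem soloInformed_posLog_inv_pow_le {L s ε X : ℝ} (p : ℕ) (hX : 0 ≤ X) (hL : 0 ≤ L) (hs : 0 < s)
    (hε : 0 < ε) (hlog : log⁺ s⁻¹ ≤ X + (L / s) ^ ε / ε) :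
    (log⁺ s⁻¹) ^ p ≤ 2 ^ p * X ^ p + 2 ^ p * ε⁻¹ ^ p * L ^ (ε * p) * s ^ (-(ε * p)) := by
  have hY : 0 ≤ (L / s) ^ ε / ε := div_nonneg (Real.rpow_nonneg (div_nonneg hL hs.le) ε) hε.le
  have h0 : 0 ≤ log⁺ s⁻¹ := Real.posLog_nonneg
  have h2 : (log⁺ s⁻¹) ^ p ≤ 2 ^ p * (X ^ p + ((L / s) ^ ε / ε) ^ p) :=
    (pow_le_pow_left₀ h0 hlog p).trans (soloInformed_add_pow_le_two_pow p hX hY)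
  have h3 := soloInformed_rpow_mul_absorb_pow (ε := ε) p hL hs 1
  rw [one_mul, one_mul] at h3
  calc (log⁺ s⁻¹) ^ p ≤ 2 ^ p * (X ^ p + ((L / s) ^ ε / ε) ^ p) := h2
    _ = 2 ^ p * X ^ p + 2 ^ p * ε⁻¹ ^ p * L ^ (ε * p) * s ^ (-(ε * p)) := by rw [h3]; ring

/-- Away from the endpoint the absorbed factor is at most one: `L^x s^{-x} ≤ 1` for `0 < L ≤ s`,
`0 ≤ x`. [cite: LionRolin1998, §1] -/
theorem soloInformed_scale_rpow_mul_le_one {L s x : ℝ} (hL : 0 < L) (hLs : L ≤ s) (hx : 0 ≤ x) :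
    L ^ x * s ^ (-x) ≤ 1 := by
  have h1 : s ^ (-x) ≤ L ^ (-x) := Real.rpow_le_rpow_of_nonpos hL hLs (neg_nonpos.2 hx)
  have h2 : L ^ x * L ^ (-x) = 1 := by
    rw [Real.rpow_neg hL.le, mul_inv_cancel₀ (Real.rpow_pos_of_pos hL x).ne']
  calc L ^ x * s ^ (-x) ≤ L ^ x * L ^ (-x) := mul_le_mul_of_nonneg_left h1 (Real.rpow_nonneg hL.le x)
    _ = 1 := h2

/-- Bookkeeping of the final constant: for `X, E, R ≥ 1` and `ι ≤ E`,
`2^p X^p + 2^p ι + 2^{p+1} ι R ≤ 2^{p+2} R E X^p`. [cite: LionRolin1998, §1] -/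
theorem soloInformed_logRoom_finalConst (p : ℕ) {X E R ι : ℝ} (hX : 1 ≤ X) (hE : 1 ≤ E) (hιE : ι ≤ E)
    (hR : 1 ≤ R) :
    2 ^ p * X ^ p + 2 ^ p * ι + 2 ^ (p + 1) * ι * R ≤ 2 ^ (p + 2) * R * E * X ^ p := by
  have hXp : 1 ≤ X ^ p := one_le_pow₀ hX
  have hE0 : 0 ≤ E := zero_le_one.trans hE
  have hR0 : 0 ≤ R := zero_le_one.trans hR
  have h1 : X ^ p ≤ R * E * X ^ p := by
    calc X ^ p = 1 * 1 * X ^ p := by ring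
      _ ≤ R * E * X ^ p := by gcongr
  have h2 : ι ≤ R * E * X ^ p := by
    calc ι ≤ E := hιE
      _ = 1 * E * 1 := by ring
      _ ≤ R * E * X ^ p := by gcongr
  have h3 : ι * R ≤ R * E * X ^ p := by
    calc ι * R ≤ E * R := by gcongr
      _ = R * E * 1 := by ring
      _ ≤ R * E * X ^ p := by gcongr
  calc 2 ^ p * X ^ p + 2 ^ p * ι + 2 ^ (p + 1) * ι * R
      = 2 ^ p * X ^ p + 2 ^ p * ι + 2 ^ (p + 1) * (ι * R) := by ring
    _ ≤ 2 ^ p * (R * E * X ^ p) + 2 ^ p * (R * E * X ^ p) + 2 ^ (p + 1) * (R * E * X ^ p) := by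
        gcongr
    _ = 2 ^ (p + 2) * R * E * X ^ p := by ring

end Summit.KontsevichZagierPeriods.KontsevichZagierPeriods.Theorems
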